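import Literature.Probability.RandomPlanarGeometry.HexSAWBrickWallStripFugacity
import Literature.Probability.RandomPlanarGeometry.HexSAWBrickWallStripDictionary
import HarnessLib

/-!
# Honeycomb strips with the PRINTED surface fugacity: `C_{T,n}(y,1)` with the weight on the level-`0` vertices only,
# its Fekete growth rate `μ_T(y,1)`, and the comparison with the row-weighted variant of `HexSAWBrickWallStripFugacity.lean`

Topic `Literature/Probability/RandomPlanarGeometry` (lane «pcv-sawmu», a-idea-1 gen 21, ed.2 gen 22: locator fixes of lit-1 gen 14 — successor material, the REPAIRED
head for the Y-family; continues `HexSAWBrickWallStripFugacity.lean` (`HexBW.stripPairs`, `HexBW.split`, `HexBW.yK`,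
`HexBW.stripZ`, `HexBW.stripMuY`) and `HexSAWBrickWallStripDictionary.lean` (`HexBW.rowIso`, `HexBW.lev_rowIso`)).
Source: N. R. Beaton, M. Bousquet-Mélou, J. de Gier, H. Duminil-Copin, A. J. Guttmann, arXiv:1109.0358v5, §3.2 p. 10
("`C_{T,k}(y,z) = Σ_{|ω|=k} y^{bc(ω)} z^{tc(ω)}`, `bc(ω)` = the number of contacts of `ω` with the bottom of the strip"; the
earlier arXiv version's notation is `c_{T,n}(i,j)`, "`i` vertices in the bottom line"), Proposition 6 p. 10 (existence of
`μ_T(y,z)`), Proposition 7 p. 11 (its proof: "arches … interacting with the bottom line of the strip") and Corollary 8 p. 12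
(proof pp. 12–13); N. Madras, G. Slade, *The Self-Avoiding Walk* (1993), §8.2, (8.2.2)–(8.2.3) p. 267 and Lemma 1.2.2 p. 9.

## Why this file

By the tree's dictionary `HexBW.lev_rowIso`, the bottom ROW `x₁ = 0` of the brick-wall strip `S_T = ℤ × {0,…,T}` is the
PAIR of Duminil-Copin–Smirnov levels `{0, 1}`: its sites of ODD abscissa are the level-`0` vertices (the printed "vertices
in the bottom line", each carrying a boundary bond), its sites of EVEN abscissa are level-`1` vertices.  The partition
function `HexBW.stripZ` of `HexSAWBrickWallStripFugacity.lean` puts the fugacity `y` on ALL bottom-row vertices, i.e. on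
two levels — a variant which is not the printed `C_{T,n}(y,1)` (a-idea-1 gen 21 audit cell `HexSAWStripFugacityConvention`:
`y ≤ HexBW.stripMuY T y`, whereas the printed `μ_T(y,1) ≤ μ(y) ≤ √y·μ`).  This file formalises the PRINTED weight:

* `bottomVisits₀ a υ n` = the number of level-`0` vertices (bottom row AND odd abscissa) of the placed walk,
  `stripZ₀ T n y = C_{T,n}(y,1) := Σ_{S_n(S_T)} y^{bottomVisits₀}` over the translation classes of `HexSAWBrickWallStrip.lean`
  (even translations preserve the abscissa parity, so the class function is well defined);
* **`stripZ₀_add_le`** — `C_{T,N+M}(y,1) ≤ max(1,y⁻¹)·C_{T,N}(y,1)·C_{T,M}(y,1)` (the split vertex, if it is a level-`0`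
  vertex, is counted twice; the proof of the row-weighted file goes through verbatim because the re-normalising translation
  `z − snorm z` has an EVEN abscissa component);
* `stripMuY₀ T y = μ_T(y,1) := inf_N (max(1,y⁻¹) C_{T,N}(y,1))^{1/N}`, **`tendsto_stripZ₀_rpow`** (`C_{T,n}(y,1)^{1/n} → μ_T(y,1)`,
  Fekete), `pow_stripMuY₀_le`, `stripMuY₀_pos`, `one_le_stripMuY₀` (`T ≥ 1`), `stripMuY₀_mono` (non-decreasing in `T`);
* the zig-zag bound of Corollary 8's proof: **`sqrt_le_stripMuY₀`** — `√y ≤ μ_T(y,1)` for `y ≥ 1` (the straight walk along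
  the bottom row has `⌊(n+1)/2⌋` or `⌈(n+1)/2⌉` level-`0` vertices);
* comparison with the row-weighted variant: `bottomVisits₀_le_bottomVisits`, `stripZ₀_le_stripZ` (`y ≥ 1`),
  `stripZ_le_stripZ₀` (`y ≤ 1`), `stripZ₀_one` (`= stripZ T n 1 = c_n(S_T)`), **`stripMuY₀_le_stripMuY`** (`y ≥ 1`),
  `stripMuY_le_stripMuY₀` (`y ≤ 1`), `stripMuY₀_one`.

Not formalised here (successor doors): Proposition 7 for `μ_T(y,1)` — strict monotonicity in `T` (the four-column insertion
of `HexSAWBrickWallStripFugacityInsertion.lean` shifts abscissae by `4`, so its bookkeeping transfers) and the limit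
`μ_T(y,1) → μ(y)` (`= HV.surfaceMu y = HV.wallRate y` of the lane's S1 files), which for THIS weight is a true target.
-/

noncomputable section

open Filter Topology Finset Literature.Probability.LatticeModels Literature.Probability.Percolation SimpleGraph

namespace Literature.Probability.RandomPlanarGeometry.SAW.HexBW

/-! ### The level-`0` visit count and the printed partition function -/

/-- The number of LEVEL-`0` vertices of the placed walk `m ↦ a + υ m`, `m ≤ n`: bottom row `x₁ = 0` AND odd abscissa
(`HexBW.lev_rowIso`: these are exactly the vertices of level `0`, the printed "vertices in the bottom line").
[cite: BeatonBousquetMelouDeGierDuminilCopinGuttmann2014, §3.2 (arXiv v5 p. 10: C_{T,k}(y,z), bc(ω) = contacts with the bottom of the strip; earlier arXiv version's notation c_{T,n}(i,j), i vertices in the bottom line)] -/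
def bottomVisits₀ (a : Site 2) (υ : ℕ → Site 2) (n : ℕ) : ℕ :=
  ∑ m ∈ Finset.range (n + 1), if (a + υ m) 1 = 0 ∧ (a + υ m) 0 % 2 = 1 then 1 else 0

/-- The level test is the printed one: a bottom-row site is a level-`0` vertex under `rowIso` iff its abscissa is odd.
[cite: DuminilCopinSmirnov2012, §3 (levels of the strip S_T)] -/
theorem lev_rowIso_eq_zero_iff_of_row_zero (v : Site 2) (hv : v 1 = 0) : HV.lev (rowIso v) = 0 ↔ v 0 % 2 = 1 := by
  rw [lev_rowIso, hv]; omega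

/-- **`C_{T,n}(y,1)`** with the printed (level-`0`) surface weight, over the translation classes of `S_T`.
[cite: BeatonBousquetMelouDeGierDuminilCopinGuttmann2014, §3.2 (arXiv v5 p. 10: C_{T,k}(y,z) = Σ_{|ω|=k} y^{bc(ω)} z^{tc(ω)}; earlier arXiv version's notation Σ c_{T,n}(i,j) y^i z^j)] -/
def stripZ₀ (T n : ℕ) (y : ℝ) : ℝ := ∑ p ∈ stripPairs T n, y ^ bottomVisits₀ p.1 p.2 n

/-- `bottomVisits₀ ≤ bottomVisits` (level `0` ⊆ bottom row). [cite: BeatonBousquetMelouDeGierDuminilCopinGuttmann2014, §3.2 (arXiv v5 p. 10)] -/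
theorem bottomVisits₀_le_bottomVisits (a : Site 2) (υ : ℕ → Site 2) (n : ℕ) :
    bottomVisits₀ a υ n ≤ bottomVisits a υ n := by
  unfold bottomVisits₀ bottomVisits
  exact Finset.sum_le_sum fun m _ => by split_ifs <;> simp_all

/-- `bottomVisits₀ ≤ n + 1`. [cite: BeatonBousquetMelouDeGierDuminilCopinGuttmann2014, §3.2 (arXiv v5 p. 10)] -/
theorem bottomVisits₀_le (a : Site 2) (υ : ℕ → Site 2) (n : ℕ) : bottomVisits₀ a υ n ≤ n + 1 :=
  (bottomVisits₀_le_bottomVisits a υ n).trans (bottomVisits_le a υ n)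

/-- `0 < C_{T,n}(y,1)` for `y > 0`. [cite: BeatonBousquetMelouDeGierDuminilCopinGuttmann2014, §3.2 (arXiv v5 p. 10)] -/
theorem stripZ₀_pos (T n : ℕ) {y : ℝ} (hy : 0 < y) : 0 < stripZ₀ T n y := by
  unfold stripZ₀
  have hne : (stripPairs T n).Nonempty := Finset.card_pos.1 (one_le_stripCount T n)
  exact Finset.sum_pos (fun p _ => pow_pos hy _) hne

/-- `C_{T,n}(y,1) ≤ C^{row}_{T,n}(y)` for `y ≥ 1` (fewer weighted vertices). [cite: BeatonBousquetMelouDeGierDuminilCopinGuttmann2014, §3.2 (arXiv v5 p. 10)] -/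
theorem stripZ₀_le_stripZ (T n : ℕ) {y : ℝ} (hy : 1 ≤ y) : stripZ₀ T n y ≤ stripZ T n y := by
  unfold stripZ₀ stripZ
  exact Finset.sum_le_sum fun p _ => pow_le_pow_right₀ hy (bottomVisits₀_le_bottomVisits _ _ _)

/-- `C^{row}_{T,n}(y) ≤ C_{T,n}(y,1)` for `0 < y ≤ 1`. [cite: BeatonBousquetMelouDeGierDuminilCopinGuttmann2014, §3.2 (arXiv v5 p. 10)] -/
theorem stripZ_le_stripZ₀ (T n : ℕ) {y : ℝ} (hy0 : 0 < y) (hy : y ≤ 1) : stripZ T n y ≤ stripZ₀ T n y := by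
  unfold stripZ₀ stripZ
  exact Finset.sum_le_sum fun p _ => pow_le_pow_of_le_one hy0.le hy (bottomVisits₀_le_bottomVisits _ _ _)

/-- At `y = 1` both are the strip count `c_n(S_T)`. [cite: MadrasSlade1993, §8.2] -/
theorem stripZ₀_one (T n : ℕ) : stripZ₀ T n 1 = stripZ T n 1 := by
  simp [stripZ₀, stripZ]

/-- **`min(1,y)^{n+1} ≤ C_{T,n}(y,1)`**. [cite: BeatonBousquetMelouDeGierDuminilCopinGuttmann2014, §3.2 (arXiv v5 p. 10)] -/
theorem min_pow_le_stripZ₀ (T n : ℕ) {y : ℝ} (hy : 0 < y) : (min 1 y) ^ (n + 1) ≤ stripZ₀ T n y := by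
  rcases le_or_gt 1 y with h1 | h1
  · rw [min_eq_left h1, one_pow]
    -- every term is `≥ 1`
    have hmem : ((0 : Site 2), Zd.straightWalk 2 n) ∈ stripPairs T n := by
      have hsw := mem_saws.1 (straightWalk_mem n)
      exact mem_stripPairs.2 ⟨zero_mem_stripStarts T, hsw.1, fun i hi => by simpa only [zero_add] using hsw.2 i hi,
        fun m _ => by
          simp only [zero_add, InStrip, Zd.straightWalk, Pi.single_eq_of_ne (one_ne_zero : (1 : Fin 2) ≠ 0)]
          exact ⟨le_rfl, by positivity⟩⟩
    have hterm : (1 : ℝ) ≤ y ^ bottomVisits₀ (0 : Site 2) (Zd.straightWalk 2 n) n := one_le_pow₀ h1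
    unfold stripZ₀
    exact hterm.trans (Finset.single_le_sum (f := fun p => y ^ bottomVisits₀ p.1 p.2 n)
      (fun p _ => pow_nonneg hy.le _) hmem)
  · have h := min_pow_le_stripZ T n hy
    rw [min_eq_right h1.le] at h ⊢
    exact h.trans (stripZ_le_stripZ₀ T n hy h1.le)

/-- For `T ≥ 1`, **`1 ≤ C_{T,n}(y,1)`**. [cite: BeatonBousquetMelouDeGierDuminilCopinGuttmann2014, §3.2 (arXiv v5 p. 10)] -/
theorem one_le_stripZ₀ {T : ℕ} (hT : 1 ≤ T) (n : ℕ) {y : ℝ} (hy : 0 < y) : 1 ≤ stripZ₀ T n y := by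
  rcases le_or_gt y 1 with h1 | h1
  · exact (one_le_stripZ hT n hy).trans (stripZ_le_stripZ₀ T n hy h1)
  · -- every term is `≥ 1` and there is at least one class
    unfold stripZ₀
    have hne : (stripPairs T n).Nonempty := Finset.card_pos.1 (one_le_stripCount T n)
    obtain ⟨p, hp⟩ := hne
    have hterm : (1 : ℝ) ≤ y ^ bottomVisits₀ p.1 p.2 n := one_le_pow₀ h1.le
    exact hterm.trans (Finset.single_le_sum (f := fun p => y ^ bottomVisits₀ p.1 p.2 n)
      (fun p _ => pow_nonneg hy.le _) hp)

/-! ### Submultiplicativity with the printed surface weight -/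

/-- The level-`0` vertices of a walk are those of its two halves, the split vertex (if it is one) counted twice — the
re-normalising translation `z − snorm z` of `HexBW.split` has an even abscissa component, so it preserves the parity test.
[cite: BeatonBousquetMelouDeGierDuminilCopinGuttmann2014, Proposition 6 (arXiv v5 p. 10: concatenation)] -/
theorem bottomVisits₀_split (a : Site 2) (ω : ℕ → Site 2) (N M : ℕ) :
    bottomVisits₀ a ω (N + M) + (if (a + ω N) 1 = 0 ∧ (a + ω N) 0 % 2 = 1 then 1 else 0) =
      bottomVisits₀ (split N M (a, ω)).1.1 (split N M (a, ω)).1.2 N +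
        bottomVisits₀ (split N M (a, ω)).2.1 (split N M (a, ω)).2.2 M := by
  unfold bottomVisits₀ split
  simp only
  have e1 : ∑ m ∈ Finset.range (N + 1), (if (a + ω (min m N)) 1 = 0 ∧ (a + ω (min m N)) 0 % 2 = 1 then 1 else 0) =
      ∑ m ∈ Finset.range (N + 1), (if (a + ω m) 1 = 0 ∧ (a + ω m) 0 % 2 = 1 then 1 else 0) :=
    Finset.sum_congr rfl fun m hm => by rw [min_eq_left (Nat.lt_succ_iff.1 (Finset.mem_range.1 hm))]
  have e2 : ∑ m ∈ Finset.range (M + 1),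
      (if (snorm (a + ω N) + (ω (N + min m M) - ω N)) 1 = 0 ∧
          (snorm (a + ω N) + (ω (N + min m M) - ω N)) 0 % 2 = 1 then 1 else 0) =
      ∑ m ∈ Finset.range (M + 1), (if (a + ω (N + m)) 1 = 0 ∧ (a + ω (N + m)) 0 % 2 = 1 then 1 else 0) :=
    Finset.sum_congr rfl fun m hm => by
      rw [min_eq_left (Nat.lt_succ_iff.1 (Finset.mem_range.1 hm))]
      have h1 : (snorm (a + ω N) + (ω (N + m) - ω N)) 1 = (a + ω (N + m)) 1 := by
        simp only [Pi.add_apply, Pi.sub_apply, snorm_apply_one]; ring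
      have h0 : (snorm (a + ω N) + (ω (N + m) - ω N)) 0 = (a 0 + ω N 0) % 2 + (ω (N + m) 0 - ω N 0) := by
        simp only [Pi.add_apply, Pi.sub_apply, snorm_apply_zero]
      have hiff : ((snorm (a + ω N) + (ω (N + m) - ω N)) 1 = 0 ∧
            (snorm (a + ω N) + (ω (N + m) - ω N)) 0 % 2 = 1) ↔
          ((a + ω (N + m)) 1 = 0 ∧ (a + ω (N + m)) 0 % 2 = 1) := by
        rw [h1, h0]
        simp only [Pi.add_apply]
        constructor
        · rintro ⟨h, h'⟩; exact ⟨h, by omega⟩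
        · rintro ⟨h, h'⟩; exact ⟨h, by omega⟩
      exact if_congr hiff rfl rfl
  rw [e1, e2, show N + M + 1 = (N + 1) + M by ring, Finset.sum_range_add, Finset.sum_range_succ' (n := M)]
  simp only [add_zero]
  have e3 : ∀ m, N + 1 + m = N + (m + 1) := fun m => by ring
  simp only [e3]
  ring

/-- **Submultiplicativity with the printed surface weight**: `C_{T,N+M}(y,1) ≤ max(1, y⁻¹) · C_{T,N}(y,1) · C_{T,M}(y,1)`.
[cite: MadrasSlade1993, §8.2, (8.2.2)–(8.2.3) (p. 267) and Lemma 1.2.2 (p. 9) — weighted form]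
[cite: BeatonBousquetMelouDeGierDuminilCopinGuttmann2014, Proposition 6 (arXiv v5 p. 10: existence of μ_T(y,z) by concatenation)] -/
theorem stripZ₀_add_le (T N M : ℕ) {y : ℝ} (hy : 0 < y) :
    stripZ₀ T (N + M) y ≤ yK y * stripZ₀ T N y * stripZ₀ T M y := by
  classical
  have hK := one_le_yK y
  -- pointwise: `y^{V(p)} ≤ K · y^{V₁} · y^{V₂}`
  have hpt : ∀ p ∈ stripPairs T (N + M), y ^ bottomVisits₀ p.1 p.2 (N + M) ≤
      yK y * (y ^ bottomVisits₀ (split N M p).1.1 (split N M p).1.2 N *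
        y ^ bottomVisits₀ (split N M p).2.1 (split N M p).2.2 M) := by
    rintro ⟨a, ω⟩ -
    have e := bottomVisits₀_split a ω N M
    rw [← pow_add, ← e, pow_add]
    split_ifs
    · rw [pow_one]
      calc y ^ bottomVisits₀ a ω (N + M) = y⁻¹ * (y ^ bottomVisits₀ a ω (N + M) * y) := by
            field_simp
        _ ≤ yK y * (y ^ bottomVisits₀ a ω (N + M) * y) :=
            mul_le_mul_of_nonneg_right (inv_le_yK y) (by positivity)
    · rw [pow_zero, mul_one]
      calc y ^ bottomVisits₀ a ω (N + M) = 1 * y ^ bottomVisits₀ a ω (N + M) := (one_mul _).symm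
        _ ≤ yK y * y ^ bottomVisits₀ a ω (N + M) := mul_le_mul_of_nonneg_right hK (by positivity)
  have hnn : ∀ q ∈ stripPairs T N ×ˢ stripPairs T M,
      0 ≤ y ^ bottomVisits₀ q.1.1 q.1.2 N * y ^ bottomVisits₀ q.2.1 q.2.2 M := fun q _ => by positivity
  calc stripZ₀ T (N + M) y
      ≤ ∑ p ∈ stripPairs T (N + M), yK y * (y ^ bottomVisits₀ (split N M p).1.1 (split N M p).1.2 N *
          y ^ bottomVisits₀ (split N M p).2.1 (split N M p).2.2 M) := Finset.sum_le_sum hpt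
    _ = yK y * ∑ q ∈ (stripPairs T (N + M)).image (split N M),
          y ^ bottomVisits₀ q.1.1 q.1.2 N * y ^ bottomVisits₀ q.2.1 q.2.2 M := by
        rw [Finset.mul_sum, Finset.sum_image (split_injOn T N M)]
    _ ≤ yK y * ∑ q ∈ stripPairs T N ×ˢ stripPairs T M,
          y ^ bottomVisits₀ q.1.1 q.1.2 N * y ^ bottomVisits₀ q.2.1 q.2.2 M := by
        refine mul_le_mul_of_nonneg_left (Finset.sum_le_sum_of_subset_of_nonneg
          (fun q hq => ?_) fun q hq _ => hnn q hq) (by linarith)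
        obtain ⟨p, hp, rfl⟩ := Finset.mem_image.1 hq
        exact split_mem hp
    _ = yK y * stripZ₀ T N y * stripZ₀ T M y := by
        rw [Finset.sum_product, stripZ₀, stripZ₀, mul_assoc, Finset.sum_mul_sum]

/-! ### The growth rate `μ_T(y,1)` and the Fekete limit -/

/-- **`μ_T(y,1) := inf_N (max(1,y⁻¹) C_{T,N}(y,1))^{1/N}`** (equal to `lim C_{T,N}(y,1)^{1/N}`, `tendsto_stripZ₀_rpow`), with the
PRINTED (level-`0`) surface weight. [cite: BeatonBousquetMelouDeGierDuminilCopinGuttmann2014, Proposition 6 (arXiv v5 p. 10: μ_T(y,z) := lim C_{T,n}(y,z)^{1/n})] -/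
def stripMuY₀ (T : ℕ) (y : ℝ) : ℝ := ⨅ n : ℕ, (yK y * stripZ₀ T (n + 1) y) ^ (1 / ((n : ℝ) + 1))

/-- `μ_T(y,1) ≤ (max(1,y⁻¹) C_{T,n}(y,1))^{1/n}` for `n ≥ 1` (printed weight). [cite: BeatonBousquetMelouDeGierDuminilCopinGuttmann2014, Proposition 6 (arXiv v5 p. 10)] -/
theorem stripMuY₀_le_rpow (T : ℕ) {y : ℝ} (hy : 0 < y) {n : ℕ} (hn : n ≠ 0) :
    stripMuY₀ T y ≤ (yK y * stripZ₀ T n y) ^ (1 / (n : ℝ)) := by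
  obtain ⟨m, rfl⟩ := Nat.exists_eq_succ_of_ne_zero hn
  have hb : BddBelow (Set.range fun m : ℕ => (yK y * stripZ₀ T (m + 1) y) ^ (1 / ((m : ℝ) + 1))) :=
    ⟨0, by
      rintro _ ⟨m, rfl⟩
      exact Real.rpow_nonneg (mul_nonneg (by linarith [one_le_yK y]) (stripZ₀_pos T _ hy).le) _⟩
  have := ciInf_le hb m
  simpa [stripMuY₀, Nat.cast_succ] using this

/-- **`μ_T(y,1)ⁿ ≤ max(1,y⁻¹) C_{T,n}(y,1)`** (printed weight). [cite: BeatonBousquetMelouDeGierDuminilCopinGuttmann2014, Proposition 6 (arXiv v5 p. 10)] -/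
theorem pow_stripMuY₀_le (T n : ℕ) {y : ℝ} (hy : 0 < y) (hμ : 0 ≤ stripMuY₀ T y) :
    stripMuY₀ T y ^ n ≤ yK y * stripZ₀ T n y := by
  have hKZ : 0 ≤ yK y * stripZ₀ T n y := mul_nonneg (by linarith [one_le_yK y]) (stripZ₀_pos T n hy).le
  rcases Nat.eq_zero_or_pos n with rfl | hn
  · rw [pow_zero]
    have := min_pow_le_stripZ₀ T 0 hy
    rw [zero_add, pow_one] at this
    -- `1 ≤ max(1,y⁻¹) · C_{T,0}(y)` since `C_{T,0}(y) ≥ min(1,y)` and `max(1,y⁻¹) min(1,y) = 1`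
    rcases le_or_gt 1 y with h1 | h1
    · rw [min_eq_left h1] at this
      calc (1 : ℝ) = 1 * 1 := by ring
        _ ≤ yK y * stripZ₀ T 0 y := mul_le_mul (one_le_yK y) this zero_le_one (by linarith [one_le_yK y])
    · rw [min_eq_right h1.le] at this
      calc (1 : ℝ) = y⁻¹ * y := by field_simp
        _ ≤ yK y * stripZ₀ T 0 y := mul_le_mul (inv_le_yK y) this hy.le (by linarith [one_le_yK y])
  · have h := stripMuY₀_le_rpow T hy hn.ne'
    calc stripMuY₀ T y ^ n ≤ ((yK y * stripZ₀ T n y) ^ (1 / (n : ℝ))) ^ n := pow_le_pow_left₀ hμ h n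
      _ = yK y * stripZ₀ T n y := by rw [one_div, Real.rpow_inv_natCast_pow hKZ hn.ne']

/-- **`C_{T,n}(y,1)^{1/n} → μ_T(y,1)`** (printed weight; Fekete's lemma for `log(max(1,y⁻¹) C_{T,n}(y,1))`, which is subadditive by
`stripZ₀_add_le`; `μ_T(y,1)` is *defined* as the infimum). [cite: BeatonBousquetMelouDeGierDuminilCopinGuttmann2014, Proposition 6 (arXiv v5 p. 10: lim C_{T,n}(y,z)^{1/n} = μ_T(y,z))] -/
theorem tendsto_stripZ₀_rpow (T : ℕ) {y : ℝ} (hy : 0 < y) :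
    Tendsto (fun n : ℕ => (stripZ₀ T n y) ^ (1 / (n : ℝ))) atTop (𝓝 (stripMuY₀ T y)) := by
  have hK := one_le_yK y
  have hK0 : 0 < yK y := by linarith
  have hpos : ∀ n, 0 < yK y * stripZ₀ T n y := fun n => mul_pos hK0 (stripZ₀_pos T n hy)
  have hu : Subadditive fun n => Real.log (yK y * stripZ₀ T n y) := by
    intro m n
    rw [← Real.log_mul (hpos m).ne' (hpos n).ne']
    apply Real.log_le_log (hpos _)
    have h := stripZ₀_add_le T m n hy
    calc yK y * stripZ₀ T (m + n) y ≤ yK y * (yK y * stripZ₀ T m y * stripZ₀ T n y) :=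
          mul_le_mul_of_nonneg_left h hK0.le
      _ = yK y * stripZ₀ T m y * (yK y * stripZ₀ T n y) := by ring
  -- lower bound: `log(K C_n) / n ≥ 2 log(min 1 y)`
  have hmin : 0 < min 1 y := lt_min one_pos hy
  have hbdd : BddBelow (Set.range fun n : ℕ => Real.log (yK y * stripZ₀ T n y) / n) := by
    refine ⟨2 * Real.log (min 1 y), ?_⟩
    rintro _ ⟨n, rfl⟩
    have hlog0 : Real.log (min 1 y) ≤ 0 := Real.log_nonpos hmin.le (min_le_left _ _)
    rcases Nat.eq_zero_or_pos n with rfl | hn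
    · simp only [Nat.cast_zero, div_zero]; linarith
    · have h1 : (min 1 y) ^ (n + 1) ≤ yK y * stripZ₀ T n y :=
        (min_pow_le_stripZ₀ T n hy).trans (le_mul_of_one_le_left (stripZ₀_pos T n hy).le hK)
      have h2 : ((n : ℝ) + 1) * Real.log (min 1 y) ≤ Real.log (yK y * stripZ₀ T n y) := by
        have := Real.log_le_log (pow_pos hmin _) h1
        rwa [Real.log_pow, Nat.cast_succ] at this
      rw [le_div_iff₀ (by exact_mod_cast hn)]
      have hn1 : (1 : ℝ) ≤ n := by exact_mod_cast hn
      nlinarith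
  have hlim := hu.tendsto_lim hbdd
  -- `K^{1/n} → 1`
  have hKlim : Tendsto (fun n : ℕ => (yK y) ^ (1 / (n : ℝ))) atTop (𝓝 1) := by
    have h1 : Tendsto (fun n : ℕ => Real.log (yK y) / (n : ℝ)) atTop (𝓝 0) :=
      tendsto_const_div_atTop_nhds_zero_nat _
    have h2 := (Real.continuous_exp.tendsto _).comp h1
    rw [Real.exp_zero] at h2
    refine h2.congr fun n => ?_
    rw [Function.comp_apply, Real.rpow_def_of_pos hK0, mul_one_div]
  have key : ∀ n : ℕ, (yK y * stripZ₀ T n y) ^ (1 / (n : ℝ)) = Real.exp (Real.log (yK y * stripZ₀ T n y) / n) :=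
    fun n => by rw [Real.rpow_def_of_pos (hpos n), mul_one_div]
  have hexp : Tendsto (fun n : ℕ => (yK y * stripZ₀ T n y) ^ (1 / (n : ℝ))) atTop (𝓝 (Real.exp hu.lim)) := by
    rw [show (fun n : ℕ => (yK y * stripZ₀ T n y) ^ (1 / (n : ℝ))) =
      fun n => Real.exp (Real.log (yK y * stripZ₀ T n y) / n) from funext key]
    exact (Real.continuous_exp.tendsto _).comp hlim
  -- identify the limit with the infimum
  have hid : Real.exp hu.lim = stripMuY₀ T y := by
    apply le_antisymm
    · refine le_ciInf fun n => ?_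
      have h1 := hu.lim_le_div hbdd (Nat.succ_ne_zero n)
      have h2 := Real.exp_le_exp.2 h1
      rw [← key (n + 1)] at h2
      simpa [Nat.cast_succ] using h2
    · refine ge_of_tendsto hexp ?_
      filter_upwards [eventually_ge_atTop 1] with n hn
      exact stripMuY₀_le_rpow T hy (by omega)
  -- remove the factor `K^{1/n}`
  have hprod : Tendsto (fun n : ℕ => (yK y)⁻¹ ^ (1 / (n : ℝ)) * (yK y * stripZ₀ T n y) ^ (1 / (n : ℝ))) atTop
      (𝓝 (stripMuY₀ T y)) := by
    have h1 : Tendsto (fun n : ℕ => (yK y)⁻¹ ^ (1 / (n : ℝ))) atTop (𝓝 1) := by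
      have := hKlim.inv₀ one_ne_zero
      rw [inv_one] at this
      refine this.congr fun n => ?_
      rw [Real.inv_rpow hK0.le]
    have := h1.mul hexp
    rwa [one_mul, hid] at this
  refine hprod.congr fun n => ?_
  rw [← Real.mul_rpow (inv_nonneg.2 hK0.le) (hpos n).le, ← mul_assoc, inv_mul_cancel₀ hK0.ne', one_mul]

/-- `0 < μ_T(y,1)` (indeed `μ_T(y,1) ≥ min(1,y)²`; printed weight). [cite: BeatonBousquetMelouDeGierDuminilCopinGuttmann2014, Proposition 6 (arXiv v5 p. 10)] -/
theorem stripMuY₀_pos (T : ℕ) {y : ℝ} (hy : 0 < y) : 0 < stripMuY₀ T y := by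
  have hmin : 0 < min 1 y := lt_min one_pos hy
  have hK := one_le_yK y
  have h : (min 1 y) ^ 2 ≤ stripMuY₀ T y := by
    refine le_ciInf fun n => ?_
    have h1 : (min 1 y) ^ (n + 1 + 1) ≤ yK y * stripZ₀ T (n + 1) y :=
      (min_pow_le_stripZ₀ T (n + 1) hy).trans (le_mul_of_one_le_left (stripZ₀_pos T _ hy).le hK)
    have h2 : ((min 1 y) ^ (n + 1 + 1)) ^ (1 / ((n : ℝ) + 1)) ≤ (yK y * stripZ₀ T (n + 1) y) ^ (1 / ((n : ℝ) + 1)) :=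
      Real.rpow_le_rpow (pow_nonneg hmin.le _) h1 (by positivity)
    refine le_trans ?_ h2
    rw [← Real.rpow_natCast (min 1 y) (n + 1 + 1), ← Real.rpow_mul hmin.le]
    have hle1 : min 1 y ≤ 1 := min_le_left _ _
    have hexp : ((n + 1 + 1 : ℕ) : ℝ) * (1 / ((n : ℝ) + 1)) ≤ 2 := by
      rw [mul_one_div, div_le_iff₀ (by positivity)]; push_cast; linarith
    calc (min 1 y) ^ 2 = (min 1 y) ^ (2 : ℝ) := by norm_cast
      _ ≤ (min 1 y) ^ (((n + 1 + 1 : ℕ) : ℝ) * (1 / ((n : ℝ) + 1))) :=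
          Real.rpow_le_rpow_of_exponent_ge hmin hle1 hexp
  exact lt_of_lt_of_le (pow_pos hmin 2) h

/-- **`1 ≤ μ_{T}(y,1)` for `T ≥ 1`** (the walks avoiding the bottom row; printed weight). [cite: BeatonBousquetMelouDeGierDuminilCopinGuttmann2014, Proposition 6 (arXiv v5 p. 10)] -/
theorem one_le_stripMuY₀ {T : ℕ} (hT : 1 ≤ T) {y : ℝ} (hy : 0 < y) : 1 ≤ stripMuY₀ T y := by
  refine le_ciInf fun n => ?_
  have h1 : (1 : ℝ) ≤ yK y * stripZ₀ T (n + 1) y :=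
    (one_le_stripZ₀ hT (n + 1) hy).trans (le_mul_of_one_le_left (stripZ₀_pos T _ hy).le (one_le_yK y))
  exact Real.one_le_rpow h1 (by positivity)

/-- `C_{T,n}(y,1) ≤ C_{T',n}(y,1)` for `T ≤ T'` (printed weight). [cite: BeatonBousquetMelouDeGierDuminilCopinGuttmann2014, §3.2 (arXiv v5 p. 10)] -/
theorem stripZ₀_mono {T T' : ℕ} (hT : T ≤ T') (n : ℕ) {y : ℝ} (hy : 0 < y) : stripZ₀ T n y ≤ stripZ₀ T' n y := by
  unfold stripZ₀
  refine Finset.sum_le_sum_of_subset_of_nonneg (fun p hp => ?_) fun p _ _ => pow_nonneg hy.le _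
  rw [mem_stripPairs] at hp ⊢
  exact ⟨stripStarts_mono hT hp.1, hp.2.1, hp.2.2.1, fun m hm => (hp.2.2.2 m hm).mono hT⟩

/-- `μ_T(y,1) ≤ μ_{T'}(y,1)` for `T ≤ T'` (printed weight; the non-strict half of Proposition 7). [cite: BeatonBousquetMelouDeGierDuminilCopinGuttmann2014, Proposition 7 (arXiv v5 p. 11)] -/
theorem stripMuY₀_mono {T T' : ℕ} (hT : T ≤ T') {y : ℝ} (hy : 0 < y) : stripMuY₀ T y ≤ stripMuY₀ T' y := by
  refine le_ciInf fun n => ?_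
  refine (stripMuY₀_le_rpow T hy (Nat.succ_ne_zero n)).trans ?_
  rw [Nat.cast_succ]
  have hK0 : 0 ≤ yK y := by linarith [one_le_yK y]
  exact Real.rpow_le_rpow (mul_nonneg hK0 (stripZ₀_pos T _ hy).le)
    (mul_le_mul_of_nonneg_left (stripZ₀_mono hT (n + 1) hy) hK0) (by positivity)

/-! ### Comparison with the row-weighted variant, and the zig-zag lower bound -/

/-- **`μ_T(y,1) ≤ μ^{row}_T(y)` for `y ≥ 1`** (`HexBW.stripMuY` weights two levels). [cite: BeatonBousquetMelouDeGierDuminilCopinGuttmann2014, Proposition 6 (arXiv v5 p. 10)] -/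
theorem stripMuY₀_le_stripMuY (T : ℕ) {y : ℝ} (hy : 1 ≤ y) : stripMuY₀ T y ≤ stripMuY T y := by
  have hy0 : 0 < y := one_pos.trans_le hy
  have hK0 : 0 ≤ yK y := by linarith [one_le_yK y]
  refine le_ciInf fun n => ?_
  refine (stripMuY₀_le_rpow T hy0 (Nat.succ_ne_zero n)).trans ?_
  rw [Nat.cast_succ]
  exact Real.rpow_le_rpow (mul_nonneg hK0 (stripZ₀_pos T _ hy0).le)
    (mul_le_mul_of_nonneg_left (stripZ₀_le_stripZ T (n + 1) hy) hK0) (by positivity)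

/-- `μ^{row}_T(y) ≤ μ_T(y,1)` for `0 < y ≤ 1`. [cite: BeatonBousquetMelouDeGierDuminilCopinGuttmann2014, Proposition 6 (arXiv v5 p. 10)] -/
theorem stripMuY_le_stripMuY₀ (T : ℕ) {y : ℝ} (hy0 : 0 < y) (hy : y ≤ 1) : stripMuY T y ≤ stripMuY₀ T y := by
  have hK0 : 0 ≤ yK y := by linarith [one_le_yK y]
  refine le_ciInf fun n => ?_
  refine (stripMuY_le_rpow T hy0 (Nat.succ_ne_zero n)).trans ?_
  rw [Nat.cast_succ]
  exact Real.rpow_le_rpow (mul_nonneg hK0 (stripZ_pos T _ hy0).le)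
    (mul_le_mul_of_nonneg_left (stripZ_le_stripZ₀ T (n + 1) hy0 hy) hK0) (by positivity)

/-- At `y = 1`: `μ_T(1,1) = μ^{row}_T(1)` (`= μ(S_T)`). [cite: MadrasSlade1993, §8.2, eq. (8.2.3)] -/
theorem stripMuY₀_one (T : ℕ) : stripMuY₀ T 1 = stripMuY T 1 :=
  le_antisymm (stripMuY₀_le_stripMuY T le_rfl) (stripMuY_le_stripMuY₀ T one_pos le_rfl)

/-- The straight walk along the bottom row has at least `⌊(n+1)/2⌋` level-`0` vertices (the odd times).
[cite: BeatonBousquetMelouDeGierDuminilCopinGuttmann2014, proof of Corollary 8 (arXiv v5 p. 12: zig-zag paths, ρ_T(y) ≤ 1/√y)] -/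
theorem div_two_le_bottomVisits₀_straightWalk (n : ℕ) :
    (n + 1) / 2 ≤ bottomVisits₀ (0 : Site 2) (Zd.straightWalk 2 n) n := by
  unfold bottomVisits₀
  have hx : ∀ m ∈ Finset.range (n + 1), ((0 : Site 2) + Zd.straightWalk 2 n m) 0 = (m : ℤ) := fun m hm => by
    simp only [Pi.add_apply, Pi.zero_apply, zero_add, Zd.straightWalk, Pi.single_eq_same,
      min_eq_left (Nat.lt_succ_iff.1 (Finset.mem_range.1 hm))]
  have hy : ∀ m, ((0 : Site 2) + Zd.straightWalk 2 n m) 1 = 0 := fun m => by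
    simp [Zd.straightWalk]
  have e : ∑ m ∈ Finset.range (n + 1),
      (if ((0 : Site 2) + Zd.straightWalk 2 n m) 1 = 0 ∧ ((0 : Site 2) + Zd.straightWalk 2 n m) 0 % 2 = 1 then 1 else 0) =
      ∑ m ∈ Finset.range (n + 1), (if m % 2 = 1 then 1 else 0) :=
    Finset.sum_congr rfl fun m hm => by
      rw [hx m hm, hy m]
      exact if_congr ⟨fun h => by omega, fun h => ⟨rfl, by omega⟩⟩ rfl rfl
  rw [e, Finset.sum_boole, Nat.cast_id]
  -- the odd numbers `< n + 1` are the images of `k ↦ 2k+1`, `k < (n+1)/2`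
  have hsub : (Finset.range ((n + 1) / 2)).image (fun k => 2 * k + 1) ⊆ (Finset.range (n + 1)).filter (fun m => m % 2 = 1) := by
    intro m hm
    obtain ⟨k, hk, rfl⟩ := Finset.mem_image.1 hm
    rw [Finset.mem_range] at hk
    exact Finset.mem_filter.2 ⟨Finset.mem_range.2 (by omega), by omega⟩
  calc (n + 1) / 2 = ((Finset.range ((n + 1) / 2)).image (fun k => 2 * k + 1)).card := by
        rw [Finset.card_image_of_injective _ (fun a b h => by simpa using h), Finset.card_range]
    _ ≤ _ := Finset.card_le_card hsub

/-- **`√y ≤ μ_T(y,1)` for every `T` and `y ≥ 1`** — the zig-zag walks sticking to the bottom line (`ρ_T(y) ≤ 1/√y`).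
[cite: BeatonBousquetMelouDeGierDuminilCopinGuttmann2014, proof of Corollary 8 (arXiv v5 p. 12: ρ_T(y) ≤ 1/√y by counting zig-zag paths)] -/
theorem sqrt_le_stripMuY₀ (T : ℕ) {y : ℝ} (hy : 1 ≤ y) : Real.sqrt y ≤ stripMuY₀ T y := by
  have hy0 : 0 < y := one_pos.trans_le hy
  have hK : 1 ≤ yK y := one_le_yK y
  refine le_ciInf fun n => ?_
  -- the straight walk contributes `y^{⌊(n+2)/2⌋} ≥ y^{(n+1)/2}` (real exponent)
  have hmem : ((0 : Site 2), Zd.straightWalk 2 (n + 1)) ∈ stripPairs T (n + 1) := by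
    have hsw := mem_saws.1 (straightWalk_mem (n + 1))
    exact mem_stripPairs.2 ⟨zero_mem_stripStarts T, hsw.1, fun i hi => by simpa only [zero_add] using hsw.2 i hi,
      fun m _ => by
        simp only [zero_add, InStrip, Zd.straightWalk, Pi.single_eq_of_ne (one_ne_zero : (1 : Fin 2) ≠ 0)]
        exact ⟨le_rfl, by positivity⟩⟩
  have hZ : y ^ ((n + 2) / 2) ≤ yK y * stripZ₀ T (n + 1) y := by
    have h1 : y ^ ((n + 2) / 2) ≤ y ^ bottomVisits₀ (0 : Site 2) (Zd.straightWalk 2 (n + 1)) (n + 1) :=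
      pow_le_pow_right₀ hy (div_two_le_bottomVisits₀_straightWalk (n + 1))
    calc y ^ ((n + 2) / 2) ≤ stripZ₀ T (n + 1) y := h1.trans (Finset.single_le_sum
          (f := fun p : Site 2 × (ℕ → Site 2) => y ^ bottomVisits₀ p.1 p.2 (n + 1)) (fun p _ => pow_nonneg hy0.le _) hmem)
      _ ≤ yK y * stripZ₀ T (n + 1) y := le_mul_of_one_le_left (stripZ₀_pos T _ hy0).le hK
  -- `√y = (y^{(n+1)/2})^{1/(n+1)} ≤ (y^{⌊(n+2)/2⌋})^{1/(n+1)}`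
  have hreal : y ^ (((n : ℝ) + 1) / 2) ≤ y ^ ((n + 2) / 2) := by
    rw [← Real.rpow_natCast y ((n + 2) / 2)]
    refine Real.rpow_le_rpow_of_exponent_le hy ?_
    have : (n + 1 : ℕ) ≤ 2 * ((n + 2) / 2) := by omega
    have h' : ((n : ℝ) + 1) ≤ 2 * (((n + 2) / 2 : ℕ) : ℝ) := by exact_mod_cast this
    linarith
  have hpos : (0 : ℝ) < (n : ℝ) + 1 := by positivity
  calc Real.sqrt y = (y ^ (((n : ℝ) + 1) / 2)) ^ (1 / ((n : ℝ) + 1)) := by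
        rw [← Real.rpow_mul hy0.le, Real.sqrt_eq_rpow]
        congr 1; field_simp
    _ ≤ (y ^ ((n + 2) / 2)) ^ (1 / ((n : ℝ) + 1)) :=
        Real.rpow_le_rpow (Real.rpow_nonneg hy0.le _) hreal (by positivity)
    _ ≤ (yK y * stripZ₀ T (n + 1) y) ^ (1 / ((n : ℝ) + 1)) :=
        Real.rpow_le_rpow (pow_nonneg hy0.le _) hZ (by positivity)

end Literature.Probability.RandomPlanarGeometry.SAW.HexBW
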